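import Summits.NavierStokesRegularity.FluidComputer.TriggeredTransferTransplant
import Literature.Analysis.FluidPDE.GavrilovSteadyEulerProofs

/-!
# Fluid computer, door N1-FC — Gavrilov's steady Euler BLOB, its zoomed copy, and the transplant flow / pressure / trigger

Cell `ns-blowup`, seat `ns-blowup-fc-prover-1` (g3; D-0074 GROUP C «bridge support»; LADDER-NS rung
N1-FC). Second of three files (`TriggeredTransferTransplant` → this → `TriggeredTransferEulerInstance`).
LABEL: E–C typing / calibration. WHAT THIS IS NOT: not Navier–Stokes evidence — a PRESCRIBED forced
Euler flow built from the tree THEOREM `gavrilov_compact_steady_euler_holds` [cite: Gavrilov2019, §1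
Theorem]; no transfer by any fluid, nothing about `TriggerScheme.Transfers`.

## Contents

* `fade` — the profile `θ(t) = Real.smoothTransition (t - 2)` (`0` for `t ≤ 2`, `1` for `t ≥ 3`,
  smooth, `θ′ = 0` off `[2, 3]`);
* `SteadyBlob` — a smooth steady Euler pair `(G, P)`, `G ≠ 0`, `div G = 0`, `(G·∇)G + ∇P = 0`,
  `supp G ⊆ B(0, r)`; `SteadyBlob.nonempty` from Gavrilov's theorem (the compact support sits in some
  ball); `xStar` (a point with `G xStar ≠ 0`), `x₀ = 4r · e₀`, the hand-over state
  `W₂ x = (2√2) • G (2 • (x - x₀))` with pressure `Q₂` (again a steady Euler pair, `steady_W₂`;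
  supported in `B̄(x₀, r/2)`, hence DISJOINT from `supp G`, `disjoint_tsupport`);
* the transplant `flow t = (1 - θ t) • G + θ t • W₂`, `pres`, `trig t = θ′(t) • (W₂ - G)`:
  `flow_classical` (a classical forced Euler solution on `[0, 5]`), `flow_zero` (`= 1 • G`),
  `flow_of_three_le` (`= W₂` from `t = 3` on), `flow_energy` (energy `≤ (1 + 2√2)² (sup ‖G‖)² ·
  vol B̄(0, 5r)` on the slab), `trig_eq_zero_of` (the trigger lives on `[2, 3] × B̄(0, 5r)`),
  `contDiff_trig`, `hasCompactSupport_trig`, `trig_bounded` (every space–time derivative of the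
  trigger is bounded — these bounds become the scheme's constants `A i` in the third file).

0 sorry; axioms ⊆ {propext, Classical.choice, Quot.sound}. References: A. V. Gavrilov, Geom. Funct.
Anal. 29 (2019) 190–197, §1 Theorem [cite: Gavrilov2019, §1 Theorem]; T. Tao, J. Amer. Math. Soc. 29
(2016) §1.3 [cite: Tao2016AveragedNS, §1.3].
-/

noncomputable section

namespace Summit.NavierStokesRegularity.FluidComputer.TriggeredTransfer

open Set MeasureTheory Function Filter Metric
open scoped ENNReal ContDiff NNReal Topology
open Literature.Analysis.FluidPDE
open Literature.Analysis.FluidPDE.FluidComputer (E3 Vel)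

/-! ## The fade profile `θ(t) = smoothTransition (t - 2)`: `0` for `t ≤ 2`, `1` for `t ≥ 3` -/

/-- The fade profile of the transplant: Mathlib's `Real.smoothTransition` shifted to rise on
`[2, 3]`. [folklore] -/
def fade (t : ℝ) : ℝ := Real.smoothTransition (t - 2)

/-- The fade profile is smooth. [folklore] -/
theorem contDiff_fade : ContDiff ℝ ∞ fade :=
  Real.smoothTransition.contDiff.comp (contDiff_id.sub contDiff_const)

/-- Its derivative is smooth. [folklore] -/
theorem contDiff_deriv_fade : ContDiff ℝ ∞ (deriv fade) :=
  (contDiff_infty_iff_deriv.mp contDiff_fade).2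

/-- `θ = 0` up to time `2`. [folklore] -/
theorem fade_of_le_two {t : ℝ} (h : t ≤ 2) : fade t = 0 :=
  Real.smoothTransition.zero_of_nonpos (by linarith)

/-- `θ = 1` from time `3` on. [folklore] -/
theorem fade_of_three_le {t : ℝ} (h : 3 ≤ t) : fade t = 1 :=
  Real.smoothTransition.one_of_one_le (by linarith)

/-- `0 ≤ θ`. [folklore] -/
theorem fade_nonneg (t : ℝ) : 0 ≤ fade t := Real.smoothTransition.nonneg _

/-- `θ ≤ 1`. [folklore] -/
theorem fade_le_one (t : ℝ) : fade t ≤ 1 := Real.smoothTransition.le_one _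

/-- `θ′ = 0` before time `2` (there `θ` vanishes identically near the point). [folklore] -/
theorem deriv_fade_of_lt_two {t : ℝ} (h : t < 2) : deriv fade t = 0 := by
  have hev : fade =ᶠ[𝓝 t] fun _ => (0 : ℝ) := by
    filter_upwards [Iio_mem_nhds h] with s hs
    exact fade_of_le_two (le_of_lt hs)
  rw [hev.deriv_eq, deriv_const]

/-- `θ′ = 0` after time `3` (there `θ ≡ 1` near the point). [folklore] -/
theorem deriv_fade_of_three_lt {t : ℝ} (h : 3 < t) : deriv fade t = 0 := by
  have hev : fade =ᶠ[𝓝 t] fun _ => (1 : ℝ) := by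
    filter_upwards [Ioi_mem_nhds h] with s hs
    exact fade_of_three_le (le_of_lt hs)
  rw [hev.deriv_eq, deriv_const]

/-! ## Compactly supported steady Euler blobs (Gavrilov) -/

/-- **A steady Euler blob**: a smooth velocity/pressure pair `(G, P)` on `ℝ³` with `div G = 0`,
`(G·∇)G + ∇P = 0` pointwise, `G ≠ 0`, and `G` supported inside the open ball `B(0, r)`, `r > 0`.
Inhabited by Gavrilov's construction (`SteadyBlob.nonempty`). A bundling of hypotheses for the
constructions below; nothing new is posited. [cite: Gavrilov2019, §1 Theorem] -/
structure SteadyBlob where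
  /-- the velocity field -/
  G : Vel
  /-- the pressure -/
  P : E3 → ℝ
  /-- a radius of a ball about the origin containing the support of `G` -/
  r : ℝ
  r_pos : 0 < r
  smooth_G : ContDiff ℝ ∞ G
  smooth_P : ContDiff ℝ ∞ P
  tsupport_subset : tsupport G ⊆ ball (0 : E3) r
  ne_zero : G ≠ 0
  divFree : VectorCalculus.IsDivFree G
  euler : ∀ x, convect G G x + gradient P x = 0

namespace SteadyBlob

/-- **Steady Euler blobs exist** — Gavrilov's smooth compactly supported steady Euler flow, a
THEOREM of the tree (`gavrilov_compact_steady_euler_holds`, file `GavrilovSteadyEulerProofs`); the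
compact support sits in some ball about the origin. [cite: Gavrilov2019, §1 Theorem] -/
theorem nonempty : Nonempty SteadyBlob := by
  obtain ⟨U, P, hU, hP, hUc, hU0, hdiv, hE⟩ :=
    gavrilov_compact_steady_euler_holds.exists_ne_zero
  obtain ⟨r, hr, hsub⟩ := (hUc.isCompact.isBounded).subset_ball_lt 0 (0 : E3)
  exact ⟨⟨U, P, r, hr, hU, hP, hsub, hU0, hdiv, hE⟩⟩

variable (B : SteadyBlob)

/-- `G` vanishes outside the ball `B(0, r)`. [folklore] -/
theorem G_eq_zero {x : E3} (hx : B.r ≤ ‖x‖) : B.G x = 0 := by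
  have hx' : x ∉ tsupport B.G := fun h => by
    have := mem_ball_zero_iff.mp (B.tsupport_subset h)
    linarith
  exact image_eq_zero_of_notMem_tsupport hx'

/-- `G` has compact support. [folklore] -/
theorem hasCompactSupport_G : HasCompactSupport B.G :=
  HasCompactSupport.intro (isCompact_closedBall (0 : E3) B.r) fun x hx =>
    B.G_eq_zero (le_of_lt (by simpa [mem_closedBall, dist_eq_norm] using hx))

/-- A point where `G` does not vanish (exists since `G ≠ 0`). [folklore] -/
def xStar : E3 := Classical.choose (Function.ne_iff.mp B.ne_zero)

/-- `G xStar ≠ 0`. [folklore] -/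
theorem G_xStar_ne : B.G B.xStar ≠ 0 := Classical.choose_spec (Function.ne_iff.mp B.ne_zero)

/-- `xStar` lies in the ball `B(0, r)`. [folklore] -/
theorem norm_xStar_lt : ‖B.xStar‖ < B.r :=
  mem_ball_zero_iff.mp (B.tsupport_subset (subset_tsupport _ (Function.mem_support.mpr B.G_xStar_ne)))

/-- A uniform bound on `‖G‖` (continuous with compact support). [folklore] -/
theorem exists_bound_G : ∃ M : ℝ, 0 ≤ M ∧ ∀ x, ‖B.G x‖ ≤ M := by
  obtain ⟨M, hM⟩ := B.smooth_G.continuous.bounded_above_of_compact_support B.hasCompactSupport_G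
  exact ⟨M, (norm_nonneg _).trans (hM 0), hM⟩

/-- The centre of the zoomed copy: `x₀ = 4r · e₀`. [folklore] -/
def x₀ : E3 := EuclideanSpace.single 0 (4 * B.r)

/-- `‖x₀‖ = 4r`. [folklore] -/
theorem norm_x₀ : ‖B.x₀‖ = 4 * B.r := by
  have h : |B.r| = B.r := abs_of_pos B.r_pos
  simp [x₀, h]

/-- **The hand-over state** `W₂ x = (2√2) • G (2 • (x - x₀))`: the `λ = 2` zoom, centred at `x₀`,
of the family member `√2 • G` one amplitude level up (`(ηλ)^{1/2} = √2` for `η = 1`, `λ = 2`).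
[folklore] -/
def W₂ : Vel := fun x => (2 * Real.sqrt 2) • B.G ((2 : ℝ) • (x - B.x₀))

/-- Its pressure `Q₂ x = (2√2)² • P (2 • (x - x₀))`. [folklore] -/
def Q₂ : E3 → ℝ := fun x => (2 * Real.sqrt 2) ^ 2 • B.P ((2 : ℝ) • (x - B.x₀))

/-- `W₂` is smooth. [folklore] -/
theorem smooth_W₂ : ContDiff ℝ ∞ B.W₂ :=
  (B.smooth_G.comp ((contDiff_id.sub contDiff_const).const_smul (2 : ℝ))).const_smul _

/-- `Q₂` is smooth. [folklore] -/
theorem smooth_Q₂ : ContDiff ℝ ∞ B.Q₂ :=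
  (B.smooth_P.comp ((contDiff_id.sub contDiff_const).const_smul (2 : ℝ))).const_smul _

/-- `(W₂, Q₂)` is again a divergence-free steady Euler pair (`steady_zoom`). [folklore] -/
theorem steady_W₂ : VectorCalculus.IsDivFree B.W₂ ∧ ∀ x, convect B.W₂ B.W₂ x + gradient B.Q₂ x = 0 :=
  steady_zoom B.smooth_G B.smooth_P B.divFree B.euler (by positivity) two_pos B.x₀

/-- `W₂` vanishes outside the ball `B(0, 5r)` (indeed outside `B̄(x₀, r/2)`). [folklore] -/
theorem W₂_eq_zero {x : E3} (hx : 5 * B.r ≤ ‖x‖) : B.W₂ x = 0 := by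
  have h1 : ‖x‖ - ‖B.x₀‖ ≤ ‖x - B.x₀‖ := norm_sub_norm_le x B.x₀
  rw [B.norm_x₀] at h1
  have h2 : B.r ≤ ‖(2 : ℝ) • (x - B.x₀)‖ := by
    rw [norm_smul, Real.norm_of_nonneg zero_le_two]
    linarith [B.r_pos]
  simp only [W₂, B.G_eq_zero h2, smul_zero]

/-- The support of `W₂` lies in the closed ball `B̄(x₀, r/2)`. [folklore] -/
theorem tsupport_W₂_subset : tsupport B.W₂ ⊆ closedBall B.x₀ (B.r / 2) := by
  refine closure_minimal (fun x hx => ?_) isClosed_closedBall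
  rw [mem_closedBall, dist_eq_norm]
  by_contra h
  push Not at h
  apply hx
  have h2 : B.r ≤ ‖(2 : ℝ) • (x - B.x₀)‖ := by
    rw [norm_smul, Real.norm_of_nonneg zero_le_two]
    linarith
  simp only [W₂, B.G_eq_zero h2, smul_zero]

/-- **The two blobs are disjointly supported**: `supp G ⊆ B(0, r)` and `supp W₂ ⊆ B̄(x₀, r/2)` with
`‖x₀‖ = 4r`. [folklore] -/
theorem disjoint_tsupport : Disjoint (tsupport B.G) (tsupport B.W₂) := by
  rw [Set.disjoint_left]
  intro x hx hx'
  have h1 : ‖x‖ < B.r := mem_ball_zero_iff.mp (B.tsupport_subset hx)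
  have h2 : ‖x - B.x₀‖ ≤ B.r / 2 := by
    have := B.tsupport_W₂_subset hx'
    rwa [mem_closedBall, dist_eq_norm] at this
  have h3 : ‖B.x₀‖ ≤ ‖B.x₀ - x‖ + ‖x‖ := by
    calc ‖B.x₀‖ = ‖(B.x₀ - x) + x‖ := by rw [sub_add_cancel]
      _ ≤ ‖B.x₀ - x‖ + ‖x‖ := norm_add_le _ _
  rw [norm_sub_rev] at h2
  rw [B.norm_x₀] at h3
  linarith [B.r_pos]

/-! ## The transplant from `G` to `W₂`: flow, pressure, trigger -/

/-- The transplant velocity `u t = (1 - θ t) • G + θ t • W₂`. [folklore] -/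
def flow (t : ℝ) (x : E3) : E3 := (1 - fade t) • B.G x + fade t • B.W₂ x

/-- The transplant pressure `p t = (1 - θ t)² • P + (θ t)² • Q₂`. [folklore] -/
def pres (t : ℝ) (x : E3) : ℝ := (1 - fade t) ^ 2 • B.P x + fade t ^ 2 • B.Q₂ x

/-- The transplant force (the "trigger", of unit relative size): `g t = θ′(t) • (W₂ - G)`.
[folklore] -/
def trig (t : ℝ) (x : E3) : E3 := deriv fade t • (B.W₂ x - B.G x)

/-- The transplant is a classical solution of the forced EULER system on `[0, T + δ] = [0, 5]`
(`isClassicalNSSolutionOn_transplant`). [folklore] -/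
theorem flow_classical : IsClassicalNSSolutionOn (Icc 0 (4 + 1)) 0 B.trig B.flow B.pres :=
  isClassicalNSSolutionOn_transplant B.smooth_G B.smooth_W₂ B.smooth_P B.smooth_Q₂ B.divFree
    B.steady_W₂.1 B.euler B.steady_W₂.2 B.disjoint_tsupport contDiff_fade
    (uniqueDiffOn_Icc (by norm_num))

/-- At time `0` the transplant is the family member `1 • G`. [folklore] -/
theorem flow_zero : B.flow 0 = fun x => (1 : ℝ) • B.G x := by
  funext x
  simp [flow, fade_of_le_two (show (0 : ℝ) ≤ 2 by norm_num)]

/-- From time `3` on the transplant IS the hand-over state `W₂`. [folklore] -/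
theorem flow_of_three_le {t : ℝ} (ht : 3 ≤ t) : B.flow t = B.W₂ := by
  funext x
  simp [flow, fade_of_three_le ht]

/-- The transplant vanishes outside the ball `B(0, 5r)` at all times. [folklore] -/
theorem flow_eq_zero {t : ℝ} {x : E3} (hx : 5 * B.r ≤ ‖x‖) : B.flow t x = 0 := by
  have h1 : B.r ≤ ‖x‖ := by linarith [B.r_pos]
  simp [flow, B.G_eq_zero h1, B.W₂_eq_zero hx]

/-- **Finite energy on the slab**: `∫ ‖u t‖² ≤ (sup ‖G‖ + 2√2 sup ‖G‖)² · vol B̄(0, 5r)` for all `t`.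
[folklore] -/
theorem flow_energy : ∃ C : ℝ≥0∞, C < ⊤ ∧ ∀ t ∈ Icc (0 : ℝ) (4 + 1), ∫⁻ x, ‖B.flow t x‖ₑ ^ 2 ≤ C := by
  obtain ⟨M, hM0, hM⟩ := B.exists_bound_G
  set K : Set E3 := closedBall (0 : E3) (5 * B.r) with hK
  set M' : ℝ := M + 2 * Real.sqrt 2 * M with hM'
  have hW₂ : ∀ x, ‖B.W₂ x‖ ≤ 2 * Real.sqrt 2 * M := fun x => by
    simp only [W₂, norm_smul, Real.norm_of_nonneg (show (0 : ℝ) ≤ 2 * Real.sqrt 2 by positivity)]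
    exact mul_le_mul_of_nonneg_left (hM _) (by positivity)
  have hbound : ∀ t x, ‖B.flow t x‖ ≤ M' := fun t x => by
    have h0 := fade_nonneg t
    have h1 := fade_le_one t
    calc ‖B.flow t x‖ ≤ ‖(1 - fade t) • B.G x‖ + ‖fade t • B.W₂ x‖ := norm_add_le _ _
      _ = (1 - fade t) * ‖B.G x‖ + fade t * ‖B.W₂ x‖ := by
          rw [norm_smul, norm_smul, Real.norm_of_nonneg (by linarith), Real.norm_of_nonneg h0]
      _ ≤ (1 - fade t) * M + fade t * (2 * Real.sqrt 2 * M) :=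
          add_le_add (mul_le_mul_of_nonneg_left (hM x) (by linarith))
            (mul_le_mul_of_nonneg_left (hW₂ x) h0)
      _ ≤ M + 2 * Real.sqrt 2 * M := by
          have e : (1 - fade t) * M = M - fade t * M := by ring
          have hθM : 0 ≤ fade t * M := mul_nonneg h0 hM0
          have h2 : fade t * (2 * Real.sqrt 2 * M) ≤ 2 * Real.sqrt 2 * M :=
            mul_le_of_le_one_left (by positivity) h1
          linarith
  refine ⟨ENNReal.ofReal M' ^ 2 * volume K, ENNReal.mul_lt_top (ENNReal.pow_lt_top ENNReal.ofReal_lt_top)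
    (isCompact_closedBall _ _).measure_lt_top, fun t _ => ?_⟩
  have hsupp : Function.support (fun x => ‖B.flow t x‖ₑ ^ 2) ⊆ K := by
    intro x hx
    by_contra hxK
    have hx5 : 5 * B.r ≤ ‖x‖ := by
      rw [hK, mem_closedBall, dist_zero_right] at hxK
      exact le_of_lt (not_le.mp hxK)
    exact hx (by simp [B.flow_eq_zero hx5])
  calc ∫⁻ x, ‖B.flow t x‖ₑ ^ 2 = ∫⁻ x in K, ‖B.flow t x‖ₑ ^ 2 :=
        (setLIntegral_eq_of_support_subset hsupp).symm
    _ ≤ ∫⁻ _ in K, ENNReal.ofReal M' ^ 2 := by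
        refine lintegral_mono fun x => ?_
        have h : ‖B.flow t x‖ₑ ≤ ENNReal.ofReal M' := by
          rw [← ofReal_norm]
          exact ENNReal.ofReal_le_ofReal (hbound t x)
        gcongr
    _ = ENNReal.ofReal M' ^ 2 * volume K := setLIntegral_const K _

/-- The trigger vanishes off `[2, 3] × B̄(0, 5r)`. [folklore] -/
theorem trig_eq_zero_of {z : ℝ × E3} (hz : z ∉ Icc (2 : ℝ) 3 ×ˢ closedBall (0 : E3) (5 * B.r)) :
    uncurry B.trig z = 0 := by
  obtain ⟨t, x⟩ := z
  simp only [uncurry_apply_pair, trig]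
  rw [Set.mem_prod, not_and_or] at hz
  rcases hz with ht | hx
  · have ht' : t < 2 ∨ 3 < t := by
      by_contra h
      push Not at h
      exact ht ⟨h.1, h.2⟩
    rcases ht' with h | h
    · rw [deriv_fade_of_lt_two h, zero_smul]
    · rw [deriv_fade_of_three_lt h, zero_smul]
  · have hx5 : 5 * B.r ≤ ‖x‖ := by
      rw [mem_closedBall, dist_zero_right] at hx
      exact le_of_lt (not_le.mp hx)
    have h1 : B.r ≤ ‖x‖ := by linarith [B.r_pos]
    rw [B.W₂_eq_zero hx5, B.G_eq_zero h1, sub_zero, smul_zero]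

/-- The trigger is jointly smooth on `ℝ × ℝ³`. [folklore] -/
theorem contDiff_trig : ContDiff ℝ ∞ (uncurry B.trig) :=
  (contDiff_deriv_fade.comp contDiff_fst).smul ((B.smooth_W₂.sub B.smooth_G).comp contDiff_snd)

/-- The trigger has compact space–time support. [folklore] -/
theorem hasCompactSupport_trig : HasCompactSupport (uncurry B.trig) :=
  HasCompactSupport.intro (isCompact_Icc.prod (isCompact_closedBall (0 : E3) (5 * B.r)))
    fun _ hz => B.trig_eq_zero_of hz

/-- Every space–time derivative of the trigger is bounded (continuous with compact support); these
bounds are the scheme's trigger constants `A i`. [folklore] -/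
theorem trig_bounded (i : ℕ) : ∃ C : ℝ, ∀ z, ‖iteratedFDeriv ℝ i (uncurry B.trig) z‖ ≤ C :=
  (B.contDiff_trig.continuous_iteratedFDeriv (m := i) (mod_cast le_top)).bounded_above_of_compact_support
    (B.hasCompactSupport_trig.iteratedFDeriv i)

end SteadyBlob

end Summit.NavierStokesRegularity.FluidComputer.TriggeredTransfer

end
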